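import Summits.QuantumFields.YangMills.Theses.ParabolicTrajectory
import Summits.QuantumFields.YangMills.Theorems.ParabolicTrajectoryLatticeGapOnTrajectoryTransferFromOSGapSlack

/-!
# Crux `LatticeGapOnTrajectory` (stmt-QuantumFields-10523) — the restatement C'' as CHECKED Lean text,
# with the re-proved assembly (planner-facing; lead a1, 2026-08-16)

Three line leads (-0, -c1, -a1) and the drefuter (gen 2) concur: conjunct (B) as filed bundles the open
infrared lattice gap with a transfer clause `∀ sch' ~ sch, ∀ T, IsYangMillsFor r sch' T → T.HasMassGap Δ`
that is underivable from the lattice half for ARBITRARY witness renormalisations `sch'`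
(`Negative/TransferObstruction.lean`: per-pair constants never transfer; what transfers is reflection
positivity, and `OSData` treats species as time-reflection scalars, so the witness renormalisations must
be reflection-symmetric). This file gives the planner the repaired texts, ELABORATED, and re-proves the
route's deciding theorem for them, so that `ledger route edit` is copy-paste:

* `LatticeGapOnTrajectoryR` — (B) with the transfer clause restricted to reflection-symmetric
  (`SpeciesScheme.IsReflectionSymmetric`, Literature) and polynomially bounded (inlined two-line text,
  verbatim the body of `Transfer.HasPolynomialRenormalisations`) witness renormalisations `sch'`.
  This is C''(ii), the MINIMAL repair. `latticeGapOnTrajectoryR_of_filed`: it is WEAKER than (B) as filed.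
* `ContinuumLimitOnTrajectoryR` — (A) whose output scheme `sch'` is, in addition, reflection-symmetric and
  polynomially bounded (physically free: the mirror species has the mirrored continuum limit with the same
  constants; lattice-perturbative renormalisations are polynomial in the cutoff).
  `continuumLimitOnTrajectory_of_R`: it is STRONGER than (A) as filed. So the repair only moves the hidden
  UV content of (B)'s transfer clause to (A), where it belongs.
* `closesR : ContinuumLimitOnTrajectoryR → LatticeGapOnTrajectoryR → TunedSequenceExists → YangMills` —
  the deciding theorem re-proved verbatim for the repaired items (the summit statement is untouched).
* `LatticeGapOnTrajectoryROS` — C''(i)+(ii): the lattice half ALSO in OS currency with superpolynomially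
  small thermal slack (`Transfer.TorusOSGapSlack`, landed p96292's hypothesis), WITHOUT any transfer clause;
  `latticeGapOnTrajectoryR_of_ROS`: it implies `LatticeGapOnTrajectoryR` by the LANDED bridge
  `Transfer.transferHalf_of_torusOSGapSlack` — i.e. under C'' the transfer conjunct is a theorem of the tree
  and the crux is a pure lattice statement (what an IR line must prove).

Note for the route edit: `Transfer.TorusOSGapSlack` / `Transfer.HasPolynomialRenormalisations` live in the
Theorems file `…LatticeGapOnTrajectoryTransferFromOSGapSlack.lean` (namespace
`…Cruxes.LatticeGapOnTrajectory.OrbitKantorovichFiniteSize.Transfer`), which does NOT import the Theses file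
(checked: this file imports both), so the route file may import it without a cycle. Still,
`LatticeGapOnTrajectoryR` / `ContinuumLimitOnTrajectoryR` below INLINE the polynomial bound and use only
Literature vocabulary (`SpeciesScheme.IsReflectionSymmetric`), so they are pasteable with the route file's
current imports plus `Literature.MathematicalPhysics.QuantumFieldTheory.SpeciesTimeReflection`; adopting
`LatticeGapOnTrajectoryROS` as the item text needs either that Theorems import or `TorusOSGapSlack` moved to
Literature (a `--kind definition` proposal next to `HasLatticeMassGap`, its natural home).

`lean check`: rc 0, 0 sorries (imports the landed bridge file, hence the Theses file).
-/

namespace Summit.QuantumFields.YangMills.Cruxes.LatticeGapOnTrajectory.Restatement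

open Filter Topology MeasureTheory
open Literature.MathematicalPhysics.QuantumFieldTheory Literature.MathematicalPhysics.QuantumLattice
open Summit.QuantumFields.YangMills.Theses.ParabolicTrajectory
open Summit.QuantumFields.YangMills.Cruxes.LatticeGapOnTrajectory.OrbitKantorovichFiniteSize

/-- **(B) repaired, C''(ii) (minimal): `LatticeGapOnTrajectoryR`.** Verbatim the filed
`LatticeGapOnTrajectory` except that the transfer clause quantifies over witness schemes `sch'` with the
same `(a, β, L)` whose renormalisations are time-reflection symmetric (`c_{Θs} = c_s`, `m_{Θs} = m_s`)
and polynomially bounded in the cutoff (`|c_s(k)|, |m_s(k)| ≤ K_s a_k^{-q_s}`). -/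
def LatticeGapOnTrajectoryR : Prop :=
  ∀ (G : Type) [Group G] [TopologicalSpace G] [IsTopologicalGroup G] [CompactSpace G],
    IsCompactSimpleLieGroup G → letI : MeasurableSpace G := borel G; haveI : BorelSpace G := ⟨rfl⟩;
    ∀ (r : LatticeRep G) (M : ℕ) (θ : ℝ) (sch : SpeciesScheme (YMSpecies G)) (n : ℕ → ℕ),
    2 ≤ M → 0 < θ → (∀ k, sch.a k = ((M : ℝ) ^ n k)⁻¹) → Filter.Tendsto sch.β Filter.atTop Filter.atTop →
    Filter.Tendsto (fun k => ((M : ℝ) ^ n k) ^ 8 *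
      latticeConnectedCorr r.ρ (sch.β k) (sch.side k) r.curvature.F r.curvature.F (M ^ n k))
      Filter.atTop (nhds θ) →
    ∃ Δ : ℝ, 0 < Δ ∧ HasLatticeMassGap r sch Δ ∧
      ∀ sch' : SpeciesScheme (YMSpecies G), sch'.a = sch.a → sch'.β = sch.β → sch'.L = sch.L →
        sch'.IsReflectionSymmetric →
        (∀ s, ∃ (q : ℕ) (K : ℝ), ∀ k,
          |sch'.c s k| ≤ K * ((sch'.a k)⁻¹) ^ q ∧ |sch'.m s k| ≤ K * ((sch'.a k)⁻¹) ^ q) →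
        ∀ T : OSData (YMSpecies G) 4, IsYangMillsFor r sch' T → T.HasMassGap Δ

/-- **(A) repaired accordingly: `ContinuumLimitOnTrajectoryR`.** Verbatim the filed
`ContinuumLimitOnTrajectory` except that the produced witness scheme `sch'` is ALSO reflection-symmetric
and polynomially bounded (the knock-on of C''(ii); physically free). -/
def ContinuumLimitOnTrajectoryR : Prop :=
  ∀ (G : Type) [Group G] [TopologicalSpace G] [IsTopologicalGroup G] [CompactSpace G],
    IsCompactSimpleLieGroup G → letI : MeasurableSpace G := borel G; haveI : BorelSpace G := ⟨rfl⟩;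
    ∀ (r : LatticeRep G), ∃ M₀ : ℕ, ∀ M : ℕ, M₀ ≤ M → 2 ≤ M → ∃ θ₀ : ℝ, 0 < θ₀ ∧
    ∀ (θ Δ : ℝ) (sch : SpeciesScheme (YMSpecies G)) (n : ℕ → ℕ), 0 < θ → θ < θ₀ → 0 < Δ →
    (∀ k, sch.a k = ((M : ℝ) ^ n k)⁻¹) → Filter.Tendsto sch.β Filter.atTop Filter.atTop →
    (∀ t : ℕ, 0 < t → ∃ c : ℝ, Filter.Tendsto (fun k => ((M : ℝ) ^ n k) ^ 8 *
      latticeConnectedCorr r.ρ (sch.β k) (sch.side k) r.curvature.F r.curvature.F (t * M ^ n k))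
      Filter.atTop (nhds c)) →
    Filter.Tendsto (fun k => ((M : ℝ) ^ n k) ^ 8 *
      latticeConnectedCorr r.ρ (sch.β k) (sch.side k) r.curvature.F r.curvature.F (M ^ n k))
      Filter.atTop (nhds θ) →
    HasLatticeMassGap r sch Δ →
    ∃ sch' : SpeciesScheme (YMSpecies G), sch'.a = sch.a ∧ sch'.β = sch.β ∧ sch'.L = sch.L ∧
      sch'.IsReflectionSymmetric ∧
      (∀ s, ∃ (q : ℕ) (K : ℝ), ∀ k,
        |sch'.c s k| ≤ K * ((sch'.a k)⁻¹) ^ q ∧ |sch'.m s k| ≤ K * ((sch'.a k)⁻¹) ^ q) ∧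
      ∃ T : OSData (YMSpecies G) 4,
        IsYangMillsFor r sch' T ∧ T.IsNontrivial r.curvature ∧ T.IsNonGaussian r.curvature

/-- The repaired (B) is WEAKER than (B) as filed (only hypotheses were added to its `∀ sch'` clause):
nothing already proved toward the filed item is lost. -/
theorem latticeGapOnTrajectoryR_of_filed (h : LatticeGapOnTrajectory) : LatticeGapOnTrajectoryR := by
  intro G _ _ _ _ hG r M θ sch n hM hθ hshape hβ htune
  obtain ⟨Δ, hΔ, hgap, htr⟩ := h G hG r M θ sch n hM hθ hshape hβ htune
  exact ⟨Δ, hΔ, hgap, fun sch' ha hb hL _ _ T hT => htr sch' ha hb hL T hT⟩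

/-- The repaired (A) is STRONGER than (A) as filed (it outputs more about `sch'`). -/
theorem continuumLimitOnTrajectory_of_R (h : ContinuumLimitOnTrajectoryR) :
    ContinuumLimitOnTrajectory := by
  intro G _ _ _ _ hG r
  obtain ⟨M₀, hM₀⟩ := h G hG r
  refine ⟨M₀, fun M hM hM2 => ?_⟩
  obtain ⟨θ₀, hθ₀, hA⟩ := hM₀ M hM hM2
  refine ⟨θ₀, hθ₀, fun θ Δ sch n hθ hθlt hΔ hshape hβ hconv htune hgap => ?_⟩
  obtain ⟨sch', ha, hb, hL, -, -, T, hT, hNT, hNG⟩ :=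
    hA θ Δ sch n hθ hθlt hΔ hshape hβ hconv htune hgap
  exact ⟨sch', ha, hb, hL, T, hT, hNT, hNG⟩

/-- **The deciding theorem, re-proved for the repaired items** (verbatim the route's `closes`, with the
two extra outputs of (A) fed to the two extra hypotheses of (B)'s transfer clause). -/
theorem closesR : ContinuumLimitOnTrajectoryR → LatticeGapOnTrajectoryR → TunedSequenceExists →
    YangMills := by
  intro hA hB hS G _ _ _ _ hG
  obtain ⟨r⟩ := hG.2
  letI : MeasurableSpace G := borel G
  haveI : BorelSpace G := ⟨rfl⟩
  obtain ⟨M₀, hM₀⟩ := hA G hG r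
  have hM2 : 2 ≤ max M₀ 2 := le_max_right _ _
  obtain ⟨θ₀, hθ₀, hA'⟩ := hM₀ (max M₀ 2) (le_max_left _ _) hM2
  obtain ⟨θ₁, hθ₁, hS'⟩ := hS G hG r (max M₀ 2) hM2
  have hθpos : 0 < min θ₀ θ₁ / 2 := by positivity
  have hθlt₀ : min θ₀ θ₁ / 2 < θ₀ := by have := min_le_left θ₀ θ₁; linarith
  have hθlt₁ : min θ₀ θ₁ / 2 < θ₁ := by have := min_le_right θ₀ θ₁; linarith
  obtain ⟨sch, n, hshape, hbeta, hconv, htune⟩ := hS' (min θ₀ θ₁ / 2) hθpos hθlt₁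
  obtain ⟨Δ, hΔ, hgap, htransfer⟩ :=
    hB G hG r (max M₀ 2) (min θ₀ θ₁ / 2) sch n hM2 hθpos hshape hbeta htune
  obtain ⟨sch', ha, hβ, hL, hsym, hpoly, T, hYM, hNT, hNG⟩ :=
    hA' (min θ₀ θ₁ / 2) Δ sch n hθpos hθlt₀ hΔ hshape hbeta hconv htune hgap
  -- buildfix 2026-08-19 (statement re-type 2026-08-16, p116790): the weak-coupling conjunct
  -- `sch'.HasWeakCouplingLimit` is (S)'s `β_k → ∞` transported along `sch'.β = sch.β` — verbatim the route's `closes`.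
  have hweak : sch'.HasWeakCouplingLimit := by
    show Filter.Tendsto sch'.β Filter.atTop Filter.atTop
    rw [hβ]
    exact hbeta
  refine ⟨r, sch', T, hweak, hYM, hNT, hNG, Δ, hΔ, htransfer sch' ha hβ hL hsym hpoly T hYM, ?_⟩
  intro A B
  obtain ⟨C, hC⟩ := hgap A B
  refine ⟨C, ?_⟩
  simpa only [ha, hβ, hL] using hC

/-- **(B) repaired, C''(i)+(ii): `LatticeGapOnTrajectoryROS`** — a PURE LATTICE statement: the filed
hypotheses imply `∃ Δ > 0` with the per-pair sup-norm gap `HasLatticeMassGap r sch Δ` (what the summit's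
lattice clause wants) AND the gap in OS currency on the scheme's tori with an `a_k`-superpolynomially
small thermal slack (`Transfer.TorusOSGapSlack r sch Δ ε`, `ε_k a_k^{-p} → 0` for all `p`). No transfer
clause: it is supplied by the landed bridge (next theorem). -/
def LatticeGapOnTrajectoryROS : Prop :=
  ∀ (G : Type) [Group G] [TopologicalSpace G] [IsTopologicalGroup G] [CompactSpace G],
    IsCompactSimpleLieGroup G → letI : MeasurableSpace G := borel G; haveI : BorelSpace G := ⟨rfl⟩;
    ∀ (r : LatticeRep G) (M : ℕ) (θ : ℝ) (sch : SpeciesScheme (YMSpecies G)) (n : ℕ → ℕ),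
    2 ≤ M → 0 < θ → (∀ k, sch.a k = ((M : ℝ) ^ n k)⁻¹) → Filter.Tendsto sch.β Filter.atTop Filter.atTop →
    Filter.Tendsto (fun k => ((M : ℝ) ^ n k) ^ 8 *
      latticeConnectedCorr r.ρ (sch.β k) (sch.side k) r.curvature.F r.curvature.F (M ^ n k))
      Filter.atTop (nhds θ) →
    ∃ Δ : ℝ, 0 < Δ ∧ HasLatticeMassGap r sch Δ ∧
      ∃ ε : ℕ → ℝ, (∀ p : ℕ, Filter.Tendsto (fun k => ε k * ((sch.a k)⁻¹) ^ p) Filter.atTop (nhds 0)) ∧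
        Transfer.TorusOSGapSlack r sch Δ ε

/-- **Under C'' the transfer conjunct is a theorem of the tree**: the pure-lattice repaired crux implies
the minimal repaired crux, by `Transfer.transferHalf_of_torusOSGapSlack` (p96292). -/
theorem latticeGapOnTrajectoryR_of_ROS (h : LatticeGapOnTrajectoryROS) : LatticeGapOnTrajectoryR := by
  intro G _ _ _ _ hG r M θ sch n hM hθ hshape hβ htune
  letI : MeasurableSpace G := borel G
  haveI : BorelSpace G := ⟨rfl⟩
  obtain ⟨Δ, hΔ, hgap, ε, hε, hOS⟩ := h G hG r M θ sch n hM hθ hshape hβ htune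
  refine ⟨Δ, hΔ, hgap, fun sch' ha hb hL hsym hpoly T hT => ?_⟩
  exact Transfer.transferHalf_of_torusOSGapSlack r M sch n Δ ε hM hshape hε hOS sch' ha hb hL hsym
    hpoly T hT

/-- Non-vacuity check of the repaired transfer hypotheses: the degenerate scheme `SpeciesScheme.zero`
is reflection-symmetric and polynomially bounded (so the restricted `∀ sch'` clause still ranges over a
non-empty class containing the vacuum witness of `transferHalf_inhabited`). -/
example {G : Type} [Group G] [TopologicalSpace G] [IsTopologicalGroup G] [MeasurableSpace G]
    [BorelSpace G] :
    (SpeciesScheme.zero (YMSpecies G)).IsReflectionSymmetric ∧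
    (∀ s, ∃ (q : ℕ) (K : ℝ), ∀ k, |(SpeciesScheme.zero (YMSpecies G)).c s k| ≤
        K * (((SpeciesScheme.zero (YMSpecies G)).a k)⁻¹) ^ q ∧
      |(SpeciesScheme.zero (YMSpecies G)).m s k| ≤ K * (((SpeciesScheme.zero (YMSpecies G)).a k)⁻¹) ^ q) :=
  ⟨SpeciesScheme.isReflectionSymmetric_zero, Transfer.hasPolynomialRenormalisations_zero _⟩

end Summit.QuantumFields.YangMills.Cruxes.LatticeGapOnTrajectory.Restatement
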